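import Summits.Ventures.PercRepro2.CaseOneDegenerate
import Summits.Ventures.PercRepro2.CaseOneThickeningRel

/-!
# The coincident marks: every statement vertex is closed (blind cell PercRepro2, p1 g29; the
companion of `CaseOneDegenerate`, which did the statement vertex coinciding with a mark)

The statement of record allows coincidences among the marks `o, a₁, a₂, b`. With two of them equal
the case-1 forms at EVERY statement vertex `a₃` reduce to a BHK inequality or vanish:
* `o = b`: `{o ∈ C₂} = {b ∈ C₂}` and `{b ∈ C₁, o ∈ C₂} ∩ Q = ∅`; at every pair `c₀, c₁ ≥ 0`,
  `(ii-t) = c₁ P(Q, b ∈ C₂, a₃ ∈ C₁) [P(Q) − P(Q, b ∈ C₂)] + c₀ [BHK 1.4 bracket] ≥ 0` and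
  `(i-t) = c₁ P(Q, b ∈ C₁) P(Q, b ∈ C₂, a₃ ∈ C₁) + c₀ [BHK 1.3 bracket] ≥ 0`;
* `o = a₁`: `{o ∈ C₂} ∩ Q = ∅`, the forms are `c₀ ·` a BHK bracket;
* `o = a₂`: `{o ∈ C₂}` is sure, the forms are `(c₁ − c₀) ·` a bracket and both pairs have `c₀ = c₁`;
* `b = a₁`, `b = a₂`: one of `{b ∈ C₁}`, `{b ∈ C₂}` is empty under `Q` and the other is sure — both
  forms vanish;
* `a₁ = a₂`: `Q = ∅`, everything vanishes.
Hence **`closedAt_of_o_eq_b`**, `closedAt_of_o_eq_a1`, `closedAt_of_o_eq_a2`, `closedAt_of_b_eq_a1`,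
`closedAt_of_b_eq_a2`, `closedAt_of_a1_eq_a2`: every marking with two coincident marks is closed at
every statement vertex. Own code; standard axioms.
-/

namespace Summit.Ventures.PercRepro2

namespace CaseOne

section Sets
variable {V : Type*} {E : Type*} {ends : E → Sym2 V} {a₁ a₂ a₃ b : V}

/-- `{b ∈ C₂} ∩ {a₃ ∈ C₁} ∩ {b ∈ C₂} ∩ Q = {b ∈ C₂} ∩ {a₃ ∈ C₁} ∩ Q`. -/
lemma ob_set₁ :
    connEvent ends a₂ b ∩ connEvent ends a₁ a₃ ∩ connEvent ends a₂ b ∩ (connEvent ends a₁ a₂)ᶜ =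
      connEvent ends a₂ b ∩ connEvent ends a₁ a₃ ∩ (connEvent ends a₁ a₂)ᶜ := by
  ext ω; simp only [Set.mem_inter_iff, Set.mem_compl_iff]; tauto

/-- `{a₃ ∈ C₁} ∩ {b ∈ C₂} ∩ Q = {b ∈ C₂} ∩ {a₃ ∈ C₁} ∩ Q`. -/
lemma ob_set₂ :
    connEvent ends a₁ a₃ ∩ connEvent ends a₂ b ∩ (connEvent ends a₁ a₂)ᶜ =
      connEvent ends a₂ b ∩ connEvent ends a₁ a₃ ∩ (connEvent ends a₁ a₂)ᶜ := by
  ext ω; simp only [Set.mem_inter_iff, Set.mem_compl_iff]; tauto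

/-- `{b ∈ C₁} ∩ {a₃ ∈ C₁} ∩ {b ∈ C₂} ∩ Q = ∅`. -/
lemma ob_set_empty :
    connEvent ends a₁ b ∩ connEvent ends a₁ a₃ ∩ connEvent ends a₂ b ∩ (connEvent ends a₁ a₂)ᶜ =
      ∅ :=
  Set.eq_empty_of_forall_notMem fun _ ⟨⟨⟨h1, _⟩, h3⟩, h4⟩ => h4 (conn_trans h1 (conn_symm h3))

/-- `S ∩ {a₂ ↔ a₁} ∩ Q = ∅`. -/
lemma inter_conn_a2_a1_inter_compl_empty (S : Set (Config E)) :
    S ∩ connEvent ends a₂ a₁ ∩ (connEvent ends a₁ a₂)ᶜ = ∅ :=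
  Set.eq_empty_of_forall_notMem fun _ ⟨⟨_, h1⟩, h2⟩ => h2 (conn_symm h1)

/-- `{a₂ ↔ a₁} ∩ S ∩ T ∩ Q = ∅`. -/
lemma conn_a2_a1_inter4_empty (S T : Set (Config E)) :
    connEvent ends a₂ a₁ ∩ S ∩ T ∩ (connEvent ends a₁ a₂)ᶜ = ∅ :=
  Set.eq_empty_of_forall_notMem fun _ ⟨⟨⟨h1, _⟩, _⟩, h2⟩ => h2 (conn_symm h1)

/-- `{a₂ ↔ a₁} ∩ S ∩ Q = ∅`. -/
lemma conn_a2_a1_inter3_empty (S : Set (Config E)) :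
    connEvent ends a₂ a₁ ∩ S ∩ (connEvent ends a₁ a₂)ᶜ = ∅ :=
  Set.eq_empty_of_forall_notMem fun _ ⟨⟨h1, _⟩, h2⟩ => h2 (conn_symm h1)

/-- `{a₂ ↔ a₁} ∩ Q = ∅`. -/
lemma conn_a2_a1_inter2_empty :
    connEvent ends a₂ a₁ ∩ (connEvent ends a₁ a₂)ᶜ = ∅ :=
  Set.eq_empty_of_forall_notMem fun _ ⟨h1, h2⟩ => h2 (conn_symm h1)

/-- `{a₁ ↔ a₂} ∩ S ∩ T ∩ Q = ∅`. -/
lemma conn_a1_a2_inter4_empty (S T : Set (Config E)) :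
    connEvent ends a₁ a₂ ∩ S ∩ T ∩ (connEvent ends a₁ a₂)ᶜ = ∅ :=
  Set.eq_empty_of_forall_notMem fun _ ⟨⟨⟨h1, _⟩, _⟩, h2⟩ => h2 h1

/-- `{a₁ ↔ a₂} ∩ S ∩ Q = ∅`. -/
lemma conn_a1_a2_inter3_empty (S : Set (Config E)) :
    connEvent ends a₁ a₂ ∩ S ∩ (connEvent ends a₁ a₂)ᶜ = ∅ :=
  Set.eq_empty_of_forall_notMem fun _ ⟨⟨h1, _⟩, h2⟩ => h2 h1

/-- `{a₁ ↔ a₂} ∩ Q = ∅`. -/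
lemma conn_a1_a2_inter2_empty :
    connEvent ends a₁ a₂ ∩ (connEvent ends a₁ a₂)ᶜ = ∅ :=
  Set.inter_compl_self _

end Sets

section Coincidences
variable {V : Type*} {E : Type*} [Fintype E] [DecidableEq E] [Fintype V] [DecidableEq V]
  {R : Type*} [CommRing R] [LinearOrder R] [IsStrictOrderedRing R]
variable {ends : E → Sym2 V}

/-! ### `o = b` -/

/-- `(ii-t)` with `o = b`, at every pair with `c₀, c₁ ≥ 0`. -/
theorem iiExprT_nonneg_of_o_eq_b {p : E → R} (hp : IsProbVec p) (a₁ a₂ a₃ b : V) (c₀ c₁ : R)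
    (hc₀ : 0 ≤ c₀) (hc₁ : 0 ≤ c₁) : 0 ≤ iiExprT p ends b a₁ a₂ a₃ b c₀ c₁ := by
  rw [iiExprT_eq, ob_set₁, ob_set₂]
  have hbhk := bhk_cross_cluster p hp ends a₂ a₁ (isUpperSet_mem_setOf b) (isUpperSet_mem_setOf a₃)
  rw [← connEvent_eq_clusterInEvent ends a₂ b, ← connEvent_eq_clusterInEvent ends a₁ a₃,
    connEvent_comm ends a₂ a₁] at hbhk
  have hmono : prob p (connEvent ends a₂ b ∩ (connEvent ends a₁ a₂)ᶜ) ≤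
      prob p (connEvent ends a₁ a₂)ᶜ :=
    prob_mono hp Set.inter_subset_right
  have hx : 0 ≤ prob p (connEvent ends a₂ b ∩ connEvent ends a₁ a₃ ∩ (connEvent ends a₁ a₂)ᶜ) :=
    prob_nonneg hp _
  have t1 := mul_nonneg (mul_nonneg hc₁ hx) (sub_nonneg.mpr hmono)
  have t2 := mul_nonneg hc₀ (sub_nonneg.mpr hbhk)
  linear_combination t1 + t2

/-- `(i-t)` with `o = b`, at every pair with `c₀, c₁ ≥ 0`. -/
theorem iExprT_nonneg_of_o_eq_b {p : E → R} (hp : IsProbVec p) (a₁ a₂ a₃ b : V) (c₀ c₁ : R)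
    (hc₀ : 0 ≤ c₀) (hc₁ : 0 ≤ c₁) : 0 ≤ iExprT p ends b a₁ a₂ a₃ b c₀ c₁ := by
  rw [iExprT_eq, ob_set_empty, prob_empty, ob_set₂]
  have hbhk := bhk_same_cluster_events p hp ends a₁ a₂ (isUpperSet_mem_setOf b)
    (isUpperSet_mem_setOf a₃)
  rw [← connEvent_eq_clusterInEvent ends a₁ b, ← connEvent_eq_clusterInEvent ends a₁ a₃] at hbhk
  have hx : 0 ≤ prob p (connEvent ends a₂ b ∩ connEvent ends a₁ a₃ ∩ (connEvent ends a₁ a₂)ᶜ) :=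
    prob_nonneg hp _
  have hy : 0 ≤ prob p (connEvent ends a₁ b ∩ (connEvent ends a₁ a₂)ᶜ) := prob_nonneg hp _
  have t1 := mul_nonneg (mul_nonneg hc₁ hy) hx
  have t2 := mul_nonneg hc₀ (sub_nonneg.mpr hbhk)
  linear_combination t1 + t2

/-- **The four forms with `o = b`, at every statement vertex.** -/
theorem fourForms_of_o_eq_b {p : E → R} (hp : IsProbVec p) (a₁ a₂ a₃ b : V) :
    FourForms p ends b a₁ a₂ a₃ b := by
  have hD : 0 ≤ Dpd p ends a₁ a₂ a₃ := prob_nonneg hp _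
  have hDo : 0 ≤ Dpdo p ends b a₁ a₂ a₃ := prob_nonneg hp _
  have hQ : 0 ≤ prob p (connEvent ends a₁ a₂)ᶜ := prob_nonneg hp _
  have hQo : 0 ≤ Dqo p ends b a₁ a₂ := prob_nonneg hp _
  refine ⟨?_, ?_, ?_, ?_⟩
  · rw [ZSplitII, iiExpr_eq_iiExprT]
    exact iiExprT_nonneg_of_o_eq_b hp a₁ a₂ a₃ b _ _ hDo hD
  · exact iiExprT_nonneg_of_o_eq_b hp a₁ a₂ a₃ b _ _ hQo hQ
  · rw [ZSplitI, iExpr_eq_iExprT]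
    exact iExprT_nonneg_of_o_eq_b hp a₁ a₂ a₃ b _ _ hDo hD
  · exact iExprT_nonneg_of_o_eq_b hp a₁ a₂ a₃ b _ _ hQo hQ

/-! ### `o = a₁` -/

/-- `(ii-t)` with `o = a₁`: `c₀ ·` BHK 1.4. -/
theorem iiExprT_nonneg_of_o_eq_a1 {p : E → R} (hp : IsProbVec p) (a₁ a₂ a₃ b : V) (c₀ c₁ : R)
    (hc₀ : 0 ≤ c₀) : 0 ≤ iiExprT p ends a₁ a₁ a₂ a₃ b c₀ c₁ := by
  rw [iiExprT_eq, inter_conn_a2_a1_inter_compl_empty, inter_conn_a2_a1_inter_compl_empty,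
    prob_empty]
  have hbhk := bhk_cross_cluster p hp ends a₂ a₁ (isUpperSet_mem_setOf b) (isUpperSet_mem_setOf a₃)
  rw [← connEvent_eq_clusterInEvent ends a₂ b, ← connEvent_eq_clusterInEvent ends a₁ a₃,
    connEvent_comm ends a₂ a₁] at hbhk
  have := mul_nonneg hc₀ (sub_nonneg.mpr hbhk)
  linear_combination this

/-- `(i-t)` with `o = a₁`: `c₀ ·` BHK 1.3. -/
theorem iExprT_nonneg_of_o_eq_a1 {p : E → R} (hp : IsProbVec p) (a₁ a₂ a₃ b : V) (c₀ c₁ : R)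
    (hc₀ : 0 ≤ c₀) : 0 ≤ iExprT p ends a₁ a₁ a₂ a₃ b c₀ c₁ := by
  rw [iExprT_eq, inter_conn_a2_a1_inter_compl_empty, inter_conn_a2_a1_inter_compl_empty,
    prob_empty]
  have hbhk := bhk_same_cluster_events p hp ends a₁ a₂ (isUpperSet_mem_setOf b)
    (isUpperSet_mem_setOf a₃)
  rw [← connEvent_eq_clusterInEvent ends a₁ b, ← connEvent_eq_clusterInEvent ends a₁ a₃] at hbhk
  have := mul_nonneg hc₀ (sub_nonneg.mpr hbhk)
  linear_combination this

/-- **The four forms with `o = a₁`, at every statement vertex.** -/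
theorem fourForms_of_o_eq_a1 {p : E → R} (hp : IsProbVec p) (a₁ a₂ a₃ b : V) :
    FourForms p ends a₁ a₁ a₂ a₃ b := by
  have hDo : 0 ≤ Dpdo p ends a₁ a₁ a₂ a₃ := prob_nonneg hp _
  have hQo : 0 ≤ Dqo p ends a₁ a₁ a₂ := prob_nonneg hp _
  refine ⟨?_, ?_, ?_, ?_⟩
  · rw [ZSplitII, iiExpr_eq_iiExprT]
    exact iiExprT_nonneg_of_o_eq_a1 hp a₁ a₂ a₃ b _ _ hDo
  · exact iiExprT_nonneg_of_o_eq_a1 hp a₁ a₂ a₃ b _ _ hQo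
  · rw [ZSplitI, iExpr_eq_iExprT]
    exact iExprT_nonneg_of_o_eq_a1 hp a₁ a₂ a₃ b _ _ hDo
  · exact iExprT_nonneg_of_o_eq_a1 hp a₁ a₂ a₃ b _ _ hQo

/-! ### `o = a₂` -/

omit [Fintype V] [DecidableEq V] [LinearOrder R] [IsStrictOrderedRing R] in
/-- With `o = a₂` both forms vanish at a pair with `c₀ = c₁`. -/
theorem iiExprT_eq_zero_of_o_eq_a2 (p : E → R) (a₁ a₂ a₃ b : V) (c : R) :
    iiExprT p ends a₂ a₁ a₂ a₃ b c c = 0 := by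
  rw [iiExprT_eq]
  simp only [connEvent_self, Set.inter_univ]
  ring

omit [Fintype V] [DecidableEq V] [LinearOrder R] [IsStrictOrderedRing R] in
/-- With `o = a₂` the `(i)` form vanishes at a pair with `c₀ = c₁`. -/
theorem iExprT_eq_zero_of_o_eq_a2 (p : E → R) (a₁ a₂ a₃ b : V) (c : R) :
    iExprT p ends a₂ a₁ a₂ a₃ b c c = 0 := by
  rw [iExprT_eq]
  simp only [connEvent_self, Set.inter_univ]
  ring

omit [Fintype V] [DecidableEq V] [LinearOrder R] [IsStrictOrderedRing R] in
/-- With `o = a₂` the PD pair is `(D, D)`. -/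
theorem Dpdo_o_eq_a2 (p : E → R) (a₁ a₂ a₃ : V) :
    Dpdo p ends a₂ a₁ a₂ a₃ = Dpd p ends a₁ a₂ a₃ := by
  unfold Dpdo Dpd
  rw [connEvent_self, Set.union_univ, Set.univ_inter]

omit [Fintype V] [DecidableEq V] [LinearOrder R] [IsStrictOrderedRing R] in
/-- With `o = a₂` the Q pair is `(P(Q), P(Q))`. -/
theorem Dqo_o_eq_a2 (p : E → R) (a₁ a₂ : V) :
    Dqo p ends a₂ a₁ a₂ = prob p (connEvent ends a₁ a₂)ᶜ := by
  unfold Dqo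
  rw [connEvent_self, Set.union_univ, Set.univ_inter]

omit [Fintype V] [DecidableEq V] [IsStrictOrderedRing R] in
/-- **The four forms with `o = a₂`, at every statement vertex.** -/
theorem fourForms_of_o_eq_a2 (p : E → R) (a₁ a₂ a₃ b : V) : FourForms p ends a₂ a₁ a₂ a₃ b := by
  refine ⟨?_, ?_, ?_, ?_⟩
  · rw [ZSplitII, iiExpr_eq_iiExprT, Dpdo_o_eq_a2, iiExprT_eq_zero_of_o_eq_a2]
  · rw [ZSplitIIQ, Dqo_o_eq_a2, iiExprT_eq_zero_of_o_eq_a2]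
  · rw [ZSplitI, iExpr_eq_iExprT, Dpdo_o_eq_a2, iExprT_eq_zero_of_o_eq_a2]
  · rw [ZSplitIQ, Dqo_o_eq_a2, iExprT_eq_zero_of_o_eq_a2]

/-! ### `b = a₁`, `b = a₂`, `a₁ = a₂` -/

omit [Fintype V] [DecidableEq V] [LinearOrder R] [IsStrictOrderedRing R] in
/-- With `b = a₁` both forms vanish at every pair. -/
theorem iiExprT_eq_zero_of_b_eq_a1 (p : E → R) (o a₁ a₂ a₃ : V) (c₀ c₁ : R) :
    iiExprT p ends o a₁ a₂ a₃ a₁ c₀ c₁ = 0 := by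
  rw [iiExprT_eq, conn_a2_a1_inter4_empty, conn_a2_a1_inter2_empty, conn_a2_a1_inter3_empty,
    prob_empty]
  ring

omit [Fintype V] [DecidableEq V] [LinearOrder R] [IsStrictOrderedRing R] in
/-- With `b = a₁` the `(i)` form vanishes at every pair. -/
theorem iExprT_eq_zero_of_b_eq_a1 (p : E → R) (o a₁ a₂ a₃ : V) (c₀ c₁ : R) :
    iExprT p ends o a₁ a₂ a₃ a₁ c₀ c₁ = 0 := by
  rw [iExprT_eq]
  simp only [connEvent_self, Set.univ_inter]
  ring

omit [Fintype V] [DecidableEq V] [IsStrictOrderedRing R] in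
/-- **The four forms with `b = a₁`, at every statement vertex.** -/
theorem fourForms_of_b_eq_a1 (p : E → R) (o a₁ a₂ a₃ : V) : FourForms p ends o a₁ a₂ a₃ a₁ := by
  refine ⟨?_, ?_, ?_, ?_⟩
  · rw [ZSplitII, iiExpr_eq_iiExprT, iiExprT_eq_zero_of_b_eq_a1]
  · rw [ZSplitIIQ, iiExprT_eq_zero_of_b_eq_a1]
  · rw [ZSplitI, iExpr_eq_iExprT, iExprT_eq_zero_of_b_eq_a1]
  · rw [ZSplitIQ, iExprT_eq_zero_of_b_eq_a1]

omit [Fintype V] [DecidableEq V] [LinearOrder R] [IsStrictOrderedRing R] in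
/-- With `b = a₂` the `(ii)` form vanishes at every pair. -/
theorem iiExprT_eq_zero_of_b_eq_a2 (p : E → R) (o a₁ a₂ a₃ : V) (c₀ c₁ : R) :
    iiExprT p ends o a₁ a₂ a₃ a₂ c₀ c₁ = 0 := by
  rw [iiExprT_eq]
  simp only [connEvent_self, Set.univ_inter]
  ring

omit [Fintype V] [DecidableEq V] [LinearOrder R] [IsStrictOrderedRing R] in
/-- With `b = a₂` the `(i)` form vanishes at every pair. -/
theorem iExprT_eq_zero_of_b_eq_a2 (p : E → R) (o a₁ a₂ a₃ : V) (c₀ c₁ : R) :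
    iExprT p ends o a₁ a₂ a₃ a₂ c₀ c₁ = 0 := by
  rw [iExprT_eq, conn_a1_a2_inter4_empty, conn_a1_a2_inter2_empty, conn_a1_a2_inter3_empty,
    prob_empty]
  ring

omit [Fintype V] [DecidableEq V] [IsStrictOrderedRing R] in
/-- **The four forms with `b = a₂`, at every statement vertex.** -/
theorem fourForms_of_b_eq_a2 (p : E → R) (o a₁ a₂ a₃ : V) : FourForms p ends o a₁ a₂ a₃ a₂ := by
  refine ⟨?_, ?_, ?_, ?_⟩
  · rw [ZSplitII, iiExpr_eq_iiExprT, iiExprT_eq_zero_of_b_eq_a2]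
  · rw [ZSplitIIQ, iiExprT_eq_zero_of_b_eq_a2]
  · rw [ZSplitI, iExpr_eq_iExprT, iExprT_eq_zero_of_b_eq_a2]
  · rw [ZSplitIQ, iExprT_eq_zero_of_b_eq_a2]

omit [Fintype V] [DecidableEq V] [LinearOrder R] [IsStrictOrderedRing R] in
/-- With `a₁ = a₂` the `(ii)` form vanishes at every pair (`Q = ∅`). -/
theorem iiExprT_eq_zero_of_a1_eq_a2 (p : E → R) (o a₁ a₃ b : V) (c₀ c₁ : R) :
    iiExprT p ends o a₁ a₁ a₃ b c₀ c₁ = 0 := by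
  rw [iiExprT_eq, connEvent_self, Set.compl_univ]
  simp only [Set.inter_empty, prob_empty]
  ring

omit [Fintype V] [DecidableEq V] [LinearOrder R] [IsStrictOrderedRing R] in
/-- With `a₁ = a₂` the `(i)` form vanishes at every pair (`Q = ∅`). -/
theorem iExprT_eq_zero_of_a1_eq_a2 (p : E → R) (o a₁ a₃ b : V) (c₀ c₁ : R) :
    iExprT p ends o a₁ a₁ a₃ b c₀ c₁ = 0 := by
  rw [iExprT_eq, connEvent_self, Set.compl_univ]
  simp only [Set.inter_empty, prob_empty]
  ring

omit [Fintype V] [DecidableEq V] [IsStrictOrderedRing R] in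
/-- **The four forms with `a₁ = a₂`, at every statement vertex.** -/
theorem fourForms_of_a1_eq_a2 (p : E → R) (o a₁ a₃ b : V) : FourForms p ends o a₁ a₁ a₃ b := by
  refine ⟨?_, ?_, ?_, ?_⟩
  · rw [ZSplitII, iiExpr_eq_iiExprT, iiExprT_eq_zero_of_a1_eq_a2]
  · rw [ZSplitIIQ, iiExprT_eq_zero_of_a1_eq_a2]
  · rw [ZSplitI, iExpr_eq_iExprT, iExprT_eq_zero_of_a1_eq_a2]
  · rw [ZSplitIQ, iExprT_eq_zero_of_a1_eq_a2]

end Coincidences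

section Closed
universe u
variable {V : Type*} [Fintype V] [DecidableEq V] {R : Type*} [CommRing R] [LinearOrder R]
  [IsStrictOrderedRing R] {E : Type u} [Fintype E] [DecidableEq E] {ends : E → Sym2 V}

/-- **`o = b`: every statement vertex is closed.** -/
theorem closedAt_of_o_eq_b (a₁ a₂ a₃ b : V) : ClosedAt R b a₁ a₂ b E ends a₃ :=
  fun _ hp => fourForms_of_o_eq_b hp a₁ a₂ a₃ b

/-- **`o = a₁`: every statement vertex is closed.** -/
theorem closedAt_of_o_eq_a1 (a₁ a₂ a₃ b : V) : ClosedAt R a₁ a₁ a₂ b E ends a₃ :=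
  fun _ hp => fourForms_of_o_eq_a1 hp a₁ a₂ a₃ b

omit [Fintype V] [DecidableEq V] [IsStrictOrderedRing R] in
/-- **`o = a₂`: every statement vertex is closed.** -/
theorem closedAt_of_o_eq_a2 (a₁ a₂ a₃ b : V) : ClosedAt R a₂ a₁ a₂ b E ends a₃ :=
  fun p _ => fourForms_of_o_eq_a2 p a₁ a₂ a₃ b

omit [Fintype V] [DecidableEq V] [IsStrictOrderedRing R] in
/-- **`b = a₁`: every statement vertex is closed.** -/
theorem closedAt_of_b_eq_a1 (o a₁ a₂ a₃ : V) : ClosedAt R o a₁ a₂ a₁ E ends a₃ :=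
  fun p _ => fourForms_of_b_eq_a1 p o a₁ a₂ a₃

omit [Fintype V] [DecidableEq V] [IsStrictOrderedRing R] in
/-- **`b = a₂`: every statement vertex is closed.** -/
theorem closedAt_of_b_eq_a2 (o a₁ a₂ a₃ : V) : ClosedAt R o a₁ a₂ a₂ E ends a₃ :=
  fun p _ => fourForms_of_b_eq_a2 p o a₁ a₂ a₃

omit [Fintype V] [DecidableEq V] [IsStrictOrderedRing R] in
/-- **`a₁ = a₂`: every statement vertex is closed.** -/
theorem closedAt_of_a1_eq_a2 (o a₁ a₃ b : V) : ClosedAt R o a₁ a₁ b E ends a₃ :=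
  fun p _ => fourForms_of_a1_eq_a2 p o a₁ a₃ b

end Closed

end CaseOne

end Summit.Ventures.PercRepro2
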